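import Summits.NavierStokesRegularity.FluidComputer.GateBudgetCleanHorizonWinding
import HarnessLib

/-!
# GateBudget part 122 — the clean dud horizon of every member, hypothesis-minimal (§322–§323)

Cell `pub-fluidc`, blueprint seat bp1 (gen 41); namespace
`Summit.NavierStokesRegularity.FluidComputer.GateBudget`, headline member
`RotorKnob.rotorCircuit K K¹⁰ ε ρ` of the two-scale family from `delayInit` (5.6), `K ≥ 16`, on
the lattice `ε = kK¹⁰ρ²` of winding number `1 ≤ k ≤ K`; modes `0 = a` (carrier), `1 = b` (clock),
`2 = c` (trigger), `3 = d` (transfer), `4 = ã` (output). HONEST FRAMING: a low prior, high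
value-of-information experiment on Tao's machine paradigm; NOT a claim that NS blows up.

WHY. Part 121 §321 states the two-sided clean dud horizon of every lattice member `k ≤ K` with
the hypotheses the GateBudget series carries internally: a trigger primitive `C` with `C' = c`
(which exists on EVERY trajectory — part 14 `exists_catalyst_primitive`), a separately
quantified clock amplitude `ε` with `0 < ε`, `ε² ≤ 1/(6K²⁰)`, the lattice window `200ε/K²⁰ ≤ ρ²`,
`K¹⁰ρ² ≤ 2ε`, and the lattice equation `ε = kK¹⁰ρ²`. Read from `ρ`, all of these are ONE
smallness condition `ρ⁴ ≤ 1/(6k²K⁴⁰)` plus `1 ≤ k ≤ K` (§322). This file files part 121's result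
with exactly the data a reader of [Tao2016AveragedNS, §5.5] has in hand — `K`, `ρ`, the winding
number `k`, the ODE (5.5) and the datum (5.6) — as part 119 did on the unit lattice.
WHAT. §322 `winding_lattice_numerics` — the arithmetic `ρ⁴ ≤ 1/(6k²K⁴⁰)`, `1 ≤ k ≤ K`, `K ≥ 16`
`⟹` the four side conditions at `ε := kK¹⁰ρ²`. §323 `knob_clean_horizon_winding_headline` —
for `K ≥ 16`, `0 < ρ`, `1 ≤ k ≤ K`, `ρ⁴ ≤ 1/(6k²K⁴⁰)` and ANY solution `X` of
`rotorCircuit K K¹⁰ (kK¹⁰ρ²) ρ` from `delayInit`: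
`K⁹/(10·(7/2 + k²/3 + 10⁻³)) ≤ cleanHorizon K (kK¹⁰ρ²) ρ X (29/20)` and
`cleanHorizon K (kK¹⁰ρ²) ρ X Θ ≤ K⁹/7 + 1` for every `Θ ≤ 3/2`. §323
`knob_clean_horizon_winding_order` — the same at the ladder's own ceiling `Θ = 29/20` with a
rounded floor: `3K⁹/(106 + 10k²) ≤ cleanHorizon K (kK¹⁰ρ²) ρ X (29/20) ≤ K⁹/7 + 1` — the clean
dud horizon of every member up to winding number `K` is of EXACT ORDER `K⁹`.
HOW. Part 121 §321 + part 14 + §322; no analysis in this file.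
HONEST LIMITS. (i) the two sides are a factor `5.01 + 0.48k²` apart (part 121's honest limit
(i): the floor is priced by part 90's crude rung price `≈ 3.83 + k²/3`, the ceiling by part 72's
leak `1/K⁹` per rung; at `k = 1` part 119 §316's `[0.065, 0.1132]K⁹` is sharper); (ii) `k ≤ K`
is where part 121's uniform log budget closes, not a dynamical threshold; (iii) `cleanHorizon`
is the supremum of the lengths of clean runs (part 118 §313), not the index at which the
machine first misfires; (iv) nothing about Navier–Stokes: inequalities about Tao's five-mode toy
circuit (5.5)/(5.6) only.
[cite: Tao2016AveragedNS, §5.5 Theorem 5.3, (5.5), (5.6), (b-eq), (c-eq), (d-eq), (ta-eq),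
(energy-con), (est)]
-/

noncomputable section

namespace Summit.NavierStokesRegularity.FluidComputer.GateBudget

open Real Set Filter Topology
open Literature.Analysis.FluidPDE.Tao2016AveragedNS

variable {K ρ : ℝ} {X : ℝ → Fin 5 → ℝ}

/-! ## §322 The lattice of winding number `k` read from `ρ` -/

/-- §322 THE LATTICE OF WINDING NUMBER `k` READ FROM `ρ` (arithmetic): for `K ≥ 16`, `0 < ρ`,
`1 ≤ k ≤ K` and `ρ⁴ ≤ 1/(6k²K⁴⁰)`, the clock amplitude `ε := kK¹⁰ρ²` satisfies `0 < ε`, `ε² ≤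
1/(6K²⁰)`, `200ε/K²⁰ ≤ ρ²` (`200k ≤ 200K ≤ K¹⁰`) and `K¹⁰ρ² ≤ 2ε` — the four side conditions on
`(ε, ρ)` carried by parts 72–121. [folklore] -/
theorem winding_lattice_numerics (hK : 16 ≤ K) (hρ : 0 < ρ) {k : ℕ} (hk1 : 1 ≤ k)
    (hkK : (k : ℝ) ≤ K) (hρK : ρ ^ 4 ≤ 1 / (6 * k ^ 2 * K ^ 40)) :
    0 < (k : ℝ) * K ^ 10 * ρ ^ 2 ∧ ((k : ℝ) * K ^ 10 * ρ ^ 2) ^ 2 ≤ 1 / (6 * K ^ 20) ∧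
      200 * ((k : ℝ) * K ^ 10 * ρ ^ 2) / K ^ 20 ≤ ρ ^ 2 ∧
      K ^ 10 * ρ ^ 2 ≤ 2 * ((k : ℝ) * K ^ 10 * ρ ^ 2) := by
  have hK0 : (0 : ℝ) < K := by linarith
  have hk1R : (1 : ℝ) ≤ k := by exact_mod_cast hk1
  have hk0 : (0 : ℝ) < k := by linarith only [hk1R]
  have hKρ : (0 : ℝ) ≤ K ^ 10 * ρ ^ 2 := by positivity
  refine ⟨by positivity, ?_, ?_, by nlinarith only [hk1R, hKρ]⟩
  · have e : ((k : ℝ) * K ^ 10 * ρ ^ 2) ^ 2 = (k : ℝ) ^ 2 * K ^ 20 * ρ ^ 4 := by ring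
    rw [e]
    calc (k : ℝ) ^ 2 * K ^ 20 * ρ ^ 4 ≤ (k : ℝ) ^ 2 * K ^ 20 * (1 / (6 * k ^ 2 * K ^ 40)) :=
          mul_le_mul_of_nonneg_left hρK (by positivity)
      _ = 1 / (6 * K ^ 20) := by
          rw [mul_one_div, div_eq_div_iff (by positivity) (by positivity)]; ring
  · have hK9big : (68719476736 : ℝ) ≤ K ^ 9 := by
      have := pow_le_pow_left₀ (by norm_num : (0 : ℝ) ≤ 16) hK 9; norm_num at this; exact this
    have h1 : (200 : ℝ) * K ≤ K ^ 9 * K := by nlinarith only [hK9big, hK0]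
    have h200 : 200 * (k : ℝ) ≤ K ^ 10 := by
      have e : K ^ 9 * K = K ^ 10 := by ring
      linarith only [hkK, h1, e]
    rw [div_le_iff₀ (by positivity)]
    have := mul_le_mul_of_nonneg_right h200 hKρ
    linarith only [this]

/-! ## §323 The clean dud horizon of every member, hypothesis-minimal -/

/-- §323 **THE CLEAN DUD HORIZON OF EVERY MEMBER `k ≤ K`, HYPOTHESIS-MINIMAL** (`K ≥ 16`, `0 <
ρ`, winding number `1 ≤ k ≤ K`, `ρ⁴ ≤ 1/(6k²K⁴⁰)`, and the ODE itself: `X` solves Tao's circuit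
`rotorCircuit K K¹⁰ (kK¹⁰ρ²) ρ` (5.5) from `delayInit` (5.6); NO trigger primitive and NO
separately quantified `ε` among the hypotheses — part 14 `exists_catalyst_primitive` and §322
`winding_lattice_numerics` discharge them): `K⁹/(10·(7/2 + k²/3 + 10⁻³)) ≤ cleanHorizon K
(kK¹⁰ρ²) ρ X (29/20)` and `cleanHorizon K (kK¹⁰ρ²) ρ X Θ ≤ K⁹/7 + 1` for every `Θ ≤ 3/2` — the
clean dud horizon of every lattice member up to winding number `K` is of EXACT ORDER `K⁹`, the
two sides a factor `5.01 + 0.48k²` apart; at `k = 1` part 119 §316's `[0.065, 0.1132]K⁹` is the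
sharper window. [derived: part 121 §321, part 14 (`exists_catalyst_primitive`), this file §322] -/
theorem knob_clean_horizon_winding_headline (hK : 16 ≤ K) (hρ : 0 < ρ) (k : ℕ) (hk1 : 1 ≤ k)
    (hkK : (k : ℝ) ≤ K) (hρK : ρ ^ 4 ≤ 1 / (6 * k ^ 2 * K ^ 40))
    (hX : ∀ t, HasDerivAt X (RotorKnob.rotorCircuit K (K ^ 10) (k * K ^ 10 * ρ ^ 2) ρ (X t)) t)
    (h0 : X 0 = delayInit) :
    K ^ 9 / (10 * (7 / 2 + k ^ 2 / 3 + 1 / 1000))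
        ≤ (cleanHorizon K (k * K ^ 10 * ρ ^ 2) ρ X (29 / 20) : ℝ) ∧
      ∀ Θ : ℝ, Θ ≤ 3 / 2 → (cleanHorizon K (k * K ^ 10 * ρ ^ 2) ρ X Θ : ℝ) ≤ K ^ 9 / 7 + 1 := by
  obtain ⟨C, hC⟩ := exists_catalyst_primitive hX
  obtain ⟨hε, hεK, hlo, hhi⟩ := winding_lattice_numerics hK hρ hk1 hkK hρK
  exact knob_clean_horizon_winding_explicit hX h0 hC hK hε hεK hρ hlo hhi k rfl hkK

/-- §323 **THE CLEAN DUD HORIZON OF EVERY MEMBER IS OF EXACT ORDER `K⁹`** (§323's hypotheses, at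
the ladder's own clock ceiling `Θ = 29/20`, the floor rounded down: `30·(7/2 + k²/3 + 10⁻³) =
105.03 + 10k² ≤ 106 + 10k²`): `3K⁹/(106 + 10k²) ≤ cleanHorizon K (kK¹⁰ρ²) ρ X (29/20) ≤ K⁹/7 + 1`.
[derived: this file `knob_clean_horizon_winding_headline`] -/
theorem knob_clean_horizon_winding_order (hK : 16 ≤ K) (hρ : 0 < ρ) (k : ℕ) (hk1 : 1 ≤ k)
    (hkK : (k : ℝ) ≤ K) (hρK : ρ ^ 4 ≤ 1 / (6 * k ^ 2 * K ^ 40))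
    (hX : ∀ t, HasDerivAt X (RotorKnob.rotorCircuit K (K ^ 10) (k * K ^ 10 * ρ ^ 2) ρ (X t)) t)
    (h0 : X 0 = delayInit) :
    3 * K ^ 9 / (106 + 10 * k ^ 2) ≤ (cleanHorizon K (k * K ^ 10 * ρ ^ 2) ρ X (29 / 20) : ℝ) ∧
      (cleanHorizon K (k * K ^ 10 * ρ ^ 2) ρ X (29 / 20) : ℝ) ≤ K ^ 9 / 7 + 1 := by
  obtain ⟨hlo, hhi⟩ := knob_clean_horizon_winding_headline hK hρ k hk1 hkK hρK hX h0
  have hK9 : (0 : ℝ) ≤ K ^ 9 := by positivity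
  refine ⟨le_trans ?_ hlo, hhi (29 / 20) (by norm_num)⟩
  rw [div_le_div_iff₀ (by positivity) (by positivity)]
  linarith only [hK9]

end Summit.NavierStokesRegularity.FluidComputer.GateBudget

end
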